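import Literature.Computability.Cryptography.CubicClassPostRoundFP
import Literature.Computability.Cryptography.HallgrenClassGroupHowellFP
import Literature.Computability.Cryptography.CEstFP
import Literature.Computability.Complexity.CodeFPLists
import Literature.Computability.Complexity.CodeFPStringKit
import HarnessLib

/-!
# The class-group post-processor on codes, II: decoding, pairing, rows and the capped subgroup order

Theorem-only sequel of `CubicClassPostRoundFP.lean` (the rounding `roundB`): the remaining stages of the post-processor of
`CubicClassPost.lean` as typed polynomial-time maps (`CodeFP`), in pointwise form over a context carrying the parameters
`P` (`T ℓe s aexp top` unary, `K₀ B` binary):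

* `codeFP_decodeUnit` (divisibility tests, the slice window), `codeFP_phi` (the digit angles `−ν/2^{ℓe(T−t)}`),
  `codeFP_coefs` (reduced pairing coefficients, `ClFP.intGcdABC`), `codeFP_deriveR` (`roundB ∘ fract` of the pairing;
  integer casts by `PeriodFinding.ratOfInt'` of `CEstFP.lean`);
* `pairRowsR_eq` — the rows are the flattened map over the `⌊|cs|/2⌋` consecutive pairs — and `codeFP_pairRowsR`;
* `lcmDen_eq`, `codeFP_lcmDen` (`HowellFP.listLcmC`), `codeFP_natRows`, and **`codeFP_postOutCap`**: the subgroup order of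
  the derived rows (`HowellFP.subgroupOrderPureC`) capped at the denominator bound — the form `PostParams.postOutC` of
  `CubicClassSamplingSpecs.lean` unfolds to.

## References

* S. Hallgren, STOC 2005, §4. [Hallgren2005]
* K. K. H. Cheung, M. Mosca, QIC 1 (2001), §3. [CheungMosca2001]
* S. Arora, B. Barak, *Computational Complexity: A Modern Approach*, CUP 2009, §1.3. [AroraBarak2009]
-/

noncomputable section

namespace Literature.Computability.Cryptography

namespace CubicClassPost

open Literature.Computability.Complexity Literature.Computability.Complexity.CodeFP Polynomial
open Literature.Algebra.EuclideanLattices (encodeRat)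
open Hallgren2005

namespace PostParams

variable {σ : Type} {eσ : σ → List Bool} {P : σ → PostParams}

/-! ### Decoding one outcome -/

/-- `W = 2^(ℓe T)` is computed on codes. [folklore] -/
theorem codeFP_W (hT : CodeFP eσ unE (fun s => (P s).T)) (hℓe : CodeFP eσ unE (fun s => (P s).ℓe)) :
    CodeFP eσ natE (fun s => (P s).W) :=
  (natPow.comp ((natPow.comp ((const eσ (2 : ℕ)).pair hℓe)).pair hT)).congr fun s => by dsimp only; unfold W; rw [← pow_mul]

/-- **Decoding one unit outcome is computed on codes** (pointwise form). [cite: Hallgren2005, §4; AroraBarak2009, §1.3] -/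
theorem codeFP_decodeUnit {c : σ → ℕ} (hT : CodeFP eσ unE (fun s => (P s).T)) (hℓe : CodeFP eσ unE (fun s => (P s).ℓe))
    (hs : CodeFP eσ unE (fun s => (P s).s)) (haexp : CodeFP eσ unE (fun s => (P s).aexp))
    (htop : CodeFP eσ unE (fun s => (P s).top)) (hK₀ : CodeFP eσ natE (fun s => (P s).K₀)) (hc : CodeFP eσ natE c) :
    CodeFP eσ (optE (pairE intE natE)) (fun s => (P s).decodeUnit (c s)) := by
  have h2 : ∀ {e : σ → ℕ}, CodeFP eσ unE e → CodeFP eσ natE (fun s => 2 ^ e s) := fun he => (natPow.comp ((const eσ (2 : ℕ)).pair he) :)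
  have hW := codeFP_W hT hℓe
  have hk : CodeFP eσ natE (fun s => c s / 2 ^ (P s).top / 2 ^ (P s).aexp) := (natDiv.comp ((natDiv.comp (hc.pair (h2 htop))).pair (h2 haexp)) :)
  have hk0 : CodeFP eσ natE (fun s => c s / 2 ^ (P s).top / 2 ^ (P s).aexp % 2 ^ (P s).s) := (natMod.comp (hk.pair (h2 hs)) :)
  have hν : CodeFP eσ natE (fun s => c s / 2 ^ (P s).top / 2 ^ (P s).aexp / 2 ^ (P s).s) := (natDiv.comp (hk.pair (h2 hs)) :)
  have hsome1 : CodeFP eσ (optE (pairE intE natE)) (fun s =>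
      some (((c s / 2 ^ (P s).top / 2 ^ (P s).aexp % 2 ^ (P s).s : ℕ) : ℤ), c s / 2 ^ (P s).top / 2 ^ (P s).aexp / 2 ^ (P s).s % (P s).W)) :=
    ((optSome _).comp ((intOfNat.comp hk0).pair (natMod.comp (hν.pair hW))) :)
  have hsome2 : CodeFP eσ (optE (pairE intE natE)) (fun s =>
      some (((c s / 2 ^ (P s).top / 2 ^ (P s).aexp % 2 ^ (P s).s : ℕ) : ℤ) - ((2 ^ (P s).s : ℕ) : ℤ),
        (c s / 2 ^ (P s).top / 2 ^ (P s).aexp / 2 ^ (P s).s + 1) % (P s).W)) :=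
    ((optSome _).comp ((intSub.comp ((intOfNat.comp hk0).pair (intOfNat.comp (h2 hs)))).pair
      (natMod.comp ((natAdd.comp (hν.pair (const eσ (1 : ℕ)))).pair hW))) :)
  have hc1 : CodeFP eσ bitE (fun s => decide (c s / 2 ^ (P s).top / 2 ^ (P s).aexp % 2 ^ (P s).s ≤ (P s).K₀)) := (natLe.comp (hk0.pair hK₀) :)
  have hc2 : CodeFP eσ bitE (fun s => decide (2 ^ (P s).s - (P s).K₀ ≤ c s / 2 ^ (P s).top / 2 ^ (P s).aexp % 2 ^ (P s).s)) :=
    (natLe.comp ((natSub.comp ((h2 hs).pair hK₀)).pair hk0) :)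
  have hc0 : CodeFP eσ bitE (fun s => decide (2 ^ (P s).top ∣ c s ∧ 2 ^ (P s).aexp ∣ c s / 2 ^ (P s).top)) := by
    have ha : CodeFP eσ bitE (fun s => decide (c s % 2 ^ (P s).top = 0)) := (natEq.comp ((natMod.comp (hc.pair (h2 htop))).pair (const eσ (0 : ℕ))) :)
    have hb : CodeFP eσ bitE (fun s => decide (c s / 2 ^ (P s).top % 2 ^ (P s).aexp = 0)) :=
      (natEq.comp ((natMod.comp ((natDiv.comp (hc.pair (h2 htop))).pair (h2 haexp))).pair (const eσ (0 : ℕ))) :)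
    exact (ha.and hb).congr fun s => by simp only [Nat.dvd_iff_mod_eq_zero, Bool.decide_and]
  have hin := hc1.ite hsome1 (hc2.ite hsome2 (const eσ none))
  refine ((hc0.ite hin (const eσ none)).congr fun s => ?_)
  unfold decodeUnit
  beta_reduce
  by_cases h0 : 2 ^ (P s).top ∣ c s ∧ 2 ^ (P s).aexp ∣ c s / 2 ^ (P s).top
  · rw [if_pos (decide_eq_true h0), if_pos h0]
    by_cases h1 : c s / 2 ^ (P s).top / 2 ^ (P s).aexp % 2 ^ (P s).s ≤ (P s).K₀
    · rw [if_pos (decide_eq_true h1), if_pos h1]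
    · rw [if_neg (by simpa using h1), if_neg h1]
      by_cases h2' : 2 ^ (P s).s - (P s).K₀ ≤ c s / 2 ^ (P s).top / 2 ^ (P s).aexp % 2 ^ (P s).s
      · rw [if_pos (decide_eq_true h2'), if_pos h2']
      · rw [if_neg (by simpa using h2'), if_neg h2']
  · rw [if_neg (by simpa using h0), if_neg h0]

/-! ### The digit angles, the pairing coefficients, the derived sample -/

/-- **The digit angle `φ_t = −ν/2^{ℓe(T−t)}` is computed on codes** (binary `t`, capped at `T`). [cite: AroraBarak2009, §1.3] -/
theorem codeFP_phi {ν t : σ → ℕ} (hT : CodeFP eσ unE (fun s => (P s).T)) (hℓe : CodeFP eσ unE (fun s => (P s).ℓe))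
    (hν : CodeFP eσ natE ν) (ht : CodeFP eσ natE t) : CodeFP eσ encodeRat (fun s => (P s).phi (ν s) (t s)) := by
  have he : CodeFP eσ unE (fun s => (P s).T - t s) :=
    (MachineA.unSub.comp (hT.pair (unOfNatMin.comp (hT.pair ht)))).congr fun s => by simp only; omega
  have hpow : CodeFP eσ natE (fun s => (2 ^ (P s).ℓe) ^ ((P s).T - t s)) := (natPow.comp ((natPow.comp ((const eσ (2 : ℕ)).pair hℓe)).pair he) :)
  refine ((ratOfIntNat.comp ((intNeg.comp (intOfNat.comp hν)).pair hpow)).congr fun s => ?_)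
  unfold phi
  push_cast
  rw [pow_mul, neg_div]

/-- **The reduced pairing coefficients are computed on codes.** [cite: Hallgren2005, §4] -/
theorem codeFP_coefs : CodeFP (pairE (pairE intE natE) (pairE intE natE)) (pairE intE intE) (fun p => coefs p.1 p.2) := by
  have ha : CodeFP (pairE (pairE intE natE) (pairE intE natE)) intE (fun p => p.1.1) := (fst _ _).fst'
  have hb : CodeFP (pairE (pairE intE natE) (pairE intE natE)) intE (fun p => p.2.1) := (snd _ _).fst'
  have hg : CodeFP (pairE (pairE intE natE) (pairE intE natE)) intE (fun p => (Int.gcd p.1.1 p.2.1 : ℤ)) :=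
    (intOfNat.comp (ClFP.intGcdABC.comp (ha.pair hb)).fst' :)
  have h1 : CodeFP (pairE (pairE intE natE) (pairE intE natE)) (pairE intE intE) (fun p => (p.2.1 / (Int.gcd p.1.1 p.2.1 : ℤ), -(p.1.1 / (Int.gcd p.1.1 p.2.1 : ℤ)))) :=
    ((intEDiv.comp (hb.pair hg)).pair (intNeg.comp (intEDiv.comp (ha.pair hg))) :)
  have hc : CodeFP (pairE (pairE intE natE) (pairE intE natE)) bitE (fun p => decide (p.1.1 = 0)) := (intEq.comp (ha.pair (const _ (0 : ℤ))) :)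
  refine ((hc.ite (const _ ((1 : ℤ), (0 : ℤ))) h1).congr fun p => ?_)
  unfold coefs
  by_cases h : p.1.1 = 0 <;> simp [h]

/-- **The reduced derived sample `ζ_t` is computed on codes** (pointwise form): the pairing of the two angles with the
reduced coefficients, its fractional part, and the bounded-denominator rounding (`codeFP_roundB_fract`).
[cite: Hallgren2005, §4; Kitaev1995, §4] -/
theorem codeFP_deriveR {u₁ u₂ : σ → ℤ × ℕ} {t : σ → ℕ} (hT : CodeFP eσ unE (fun s => (P s).T))
    (hℓe : CodeFP eσ unE (fun s => (P s).ℓe)) (hB : CodeFP eσ natE (fun s => (P s).B))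
    (hu₁ : CodeFP eσ (pairE intE natE) u₁) (hu₂ : CodeFP eσ (pairE intE natE) u₂) (ht : CodeFP eσ natE t) :
    CodeFP eσ encodeRat (fun s => (P s).deriveR (u₁ s) (u₂ s) (t s)) := by
  have hco := codeFP_coefs.comp (hu₁.pair hu₂)
  have hφ1 := codeFP_phi hT hℓe hu₁.snd' ht
  have hφ2 := codeFP_phi hT hℓe hu₂.snd' ht
  have hx : CodeFP eσ encodeRat (fun s => ((coefs (u₁ s) (u₂ s)).1 : ℚ) * (P s).phi (u₁ s).2 (t s) +
      ((coefs (u₁ s) (u₂ s)).2 : ℚ) * (P s).phi (u₂ s).2 (t s)) :=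
    (ratAdd.comp ((ratMul.comp ((PeriodFinding.ratOfInt'.comp hco.fst').pair hφ1)).pair (ratMul.comp ((PeriodFinding.ratOfInt'.comp hco.snd').pair hφ2))) :)
  exact ((codeFP_roundB_fract.comp (hB.pair hx)).congr fun s => rfl :)

/-! ### The rows -/

/-- **The derived rows are the flattened map over the consecutive pairs** (the step written with `Option.elim`).
[folklore] -/
theorem pairRowsR_eq (P : PostParams) : ∀ cs : List ℕ, P.pairRowsR cs =
    ((List.range (cs.length / 2)).map fun i => (P.decodeUnit (cs.getD (2 * i) 0)).elim [] fun u₁ =>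
      (P.decodeUnit (cs.getD (2 * i + 1) 0)).elim [] fun u₂ => [(List.range P.T).map (P.deriveR u₁ u₂)]).flatten
  | [] => rfl
  | [_] => by simp [pairRowsR]
  | c₁ :: c₂ :: cs => by
    rw [pairRowsR, pairRowsR_eq P cs]
    have hl : (c₁ :: c₂ :: cs).length / 2 = cs.length / 2 + 1 := by simp only [List.length_cons]; omega
    have e0 : (c₁ :: c₂ :: cs).getD (2 * 0) 0 = c₁ := rfl
    have e1 : (c₁ :: c₂ :: cs).getD (2 * 0 + 1) 0 = c₂ := rfl
    have e2 : ∀ i, (c₁ :: c₂ :: cs).getD (2 * Nat.succ i) 0 = cs.getD (2 * i) 0 := fun i => by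
      rw [show 2 * Nat.succ i = 2 * i + 1 + 1 by rw [Nat.succ_eq_add_one]; ring, List.getD_cons_succ, List.getD_cons_succ]
    have e3 : ∀ i, (c₁ :: c₂ :: cs).getD (2 * Nat.succ i + 1) 0 = cs.getD (2 * i + 1) 0 := fun i => by
      rw [show 2 * Nat.succ i + 1 = 2 * i + 1 + 1 + 1 by rw [Nat.succ_eq_add_one]; ring, List.getD_cons_succ, List.getD_cons_succ]
    simp only [hl, List.range_succ_eq_map, List.map_cons, List.map_map, List.flatten_cons, Function.comp_def, e0, e1, e2, e3]
    congr 1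
    cases P.decodeUnit c₁ <;> cases P.decodeUnit c₂ <;> rfl

/-- **The derived rows are computed on codes** (pointwise form). [cite: Hallgren2005, §4; AroraBarak2009, §1.3] -/
theorem codeFP_pairRowsR {cs : σ → List ℕ} (hT : CodeFP eσ unE (fun s => (P s).T)) (hℓe : CodeFP eσ unE (fun s => (P s).ℓe))
    (hs : CodeFP eσ unE (fun s => (P s).s)) (haexp : CodeFP eσ unE (fun s => (P s).aexp))
    (htop : CodeFP eσ unE (fun s => (P s).top)) (hK₀ : CodeFP eσ natE (fun s => (P s).K₀)) (hB : CodeFP eσ natE (fun s => (P s).B))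
    (hcs : CodeFP eσ (rawE natE) cs) :
    CodeFP eσ (rawE (rawE encodeRat)) (fun s => (P s).pairRowsR (cs s)) := by
  -- the row of a decoded pair, context `r = (((s, i), u₁), u₂)`
  have r1 : CodeFP (pairE (pairE (pairE (pairE eσ natE) (pairE intE natE)) (pairE intE natE)) natE) eσ (fun q => q.1.1.1.1) :=
    (fst _ _).fst'.fst'.fst'
  have hrowi : CodeFP (pairE (pairE (pairE (pairE eσ natE) (pairE intE natE)) (pairE intE natE)) natE) encodeRat
      (fun q => (P q.1.1.1.1).deriveR q.1.1.2 q.1.2 q.2) :=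
    codeFP_deriveR (σ := (((σ × ℕ) × (ℤ × ℕ)) × (ℤ × ℕ)) × ℕ) (P := fun q => P q.1.1.1.1) (u₁ := fun q => q.1.1.2) (u₂ := fun q => q.1.2)
      (t := fun q => q.2) (hT.comp r1) (hℓe.comp r1) (hB.comp r1) (fst _ _).fst'.snd' (fst _ _).snd' (snd _ _)
  have hrow : CodeFP (pairE (pairE (pairE eσ natE) (pairE intE natE)) (pairE intE natE)) (rawE (rawE encodeRat))
      (fun r => [(List.range (P r.1.1.1).T).map ((P r.1.1.1).deriveR r.1.2 r.2)]) :=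
    ((rawSingleton _).comp ((map hrowi).comp ((CodeFP.id _).pair (urange.comp (hT.comp (fst _ _).fst'.fst')))) :)
  -- the two decodings, context `(s, i)`
  have e1 : CodeFP (pairE eσ natE) eσ (fun w => w.1) := fst _ _
  have hc₁ : CodeFP (pairE eσ natE) natE (fun w => (cs w.1).getD (2 * w.2) 0) :=
    ((rawGetD natE natE_zero).comp ((hcs.comp e1).pair (natMul.comp ((const _ (2 : ℕ)).pair (snd _ _)))) :)
  have hc₂ : CodeFP (pairE eσ natE) natE (fun w => (cs w.1).getD (2 * w.2 + 1) 0) :=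
    ((rawGetD natE natE_zero).comp ((hcs.comp e1).pair (natAdd.comp ((natMul.comp ((const _ (2 : ℕ)).pair (snd _ _))).pair (const _ (1 : ℕ))))) :)
  have hd₁ := codeFP_decodeUnit (σ := σ × ℕ) (P := fun w => P w.1) (c := fun w => (cs w.1).getD (2 * w.2) 0)
    (hT.comp e1) (hℓe.comp e1) (hs.comp e1) (haexp.comp e1) (htop.comp e1) (hK₀.comp e1) hc₁
  have hd₂ := codeFP_decodeUnit (σ := σ × ℕ) (P := fun w => P w.1) (c := fun w => (cs w.1).getD (2 * w.2 + 1) 0)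
    (hT.comp e1) (hℓe.comp e1) (hs.comp e1) (haexp.comp e1) (htop.comp e1) (hK₀.comp e1) hc₂
  -- inner case analysis on the second decoding, context `((s, i), u₁)`
  have hin := optCases (σ := (σ × ℕ) × (ℤ × ℕ)) (eσ := pairE (pairE eσ natE) (pairE intE natE)) (eα := pairE intE natE)
    (eδ := rawE (rawE encodeRat))
    (k := fun q o => o.elim [] fun u₂ => [(List.range (P q.1.1).T).map ((P q.1.1).deriveR q.2 u₂)])
    (gnone := fun _ => []) (gsome := fun r => [(List.range (P r.1.1.1).T).map ((P r.1.1.1).deriveR r.1.2 r.2)])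
    (const _ []) hrow (fun _ => rfl) (fun _ _ => rfl)
  have hin' : CodeFP (pairE (pairE eσ natE) (pairE intE natE)) (rawE (rawE encodeRat))
      (fun q => ((P q.1.1).decodeUnit ((cs q.1.1).getD (2 * q.1.2 + 1) 0)).elim [] fun u₂ =>
        [(List.range (P q.1.1).T).map ((P q.1.1).deriveR q.2 u₂)]) :=
    (hin.comp ((CodeFP.id _).pair (hd₂.comp (fst _ _))) :)
  have hout := optCases (σ := σ × ℕ) (eσ := pairE eσ natE) (eα := pairE intE natE) (eδ := rawE (rawE encodeRat))
    (k := fun w o => o.elim [] fun u₁ => ((P w.1).decodeUnit ((cs w.1).getD (2 * w.2 + 1) 0)).elim [] fun u₂ =>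
      [(List.range (P w.1).T).map ((P w.1).deriveR u₁ u₂)])
    (gnone := fun _ => [])
    (gsome := fun q => ((P q.1.1).decodeUnit ((cs q.1.1).getD (2 * q.1.2 + 1) 0)).elim [] fun u₂ =>
      [(List.range (P q.1.1).T).map ((P q.1.1).deriveR q.2 u₂)])
    (const _ []) hin' (fun _ => rfl) (fun _ _ => rfl)
  have hitem : CodeFP (pairE eσ natE) (rawE (rawE encodeRat))
      (fun w => ((P w.1).decodeUnit ((cs w.1).getD (2 * w.2) 0)).elim [] fun u₁ =>
        ((P w.1).decodeUnit ((cs w.1).getD (2 * w.2 + 1) 0)).elim [] fun u₂ => [(List.range (P w.1).T).map ((P w.1).deriveR u₁ u₂)]) :=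
    (hout.comp ((CodeFP.id _).pair hd₁) :)
  -- the pair indices `range (|cs| / 2)` and the flattened map
  have hidx : CodeFP eσ (rawE natE) (fun s => List.range ((cs s).length / 2)) :=
    (rangeOf.comp (((ulength natE).comp hcs).pair (natDiv.comp (((natLength natE).comp hcs).pair (const eσ (2 : ℕ)))))).congr
      fun s => by dsimp only; rw [min_eq_left (Nat.div_le_self _ _)]
  have hrows := (flatten (rawE encodeRat)).comp ((map hitem).comp ((CodeFP.id _).pair hidx))
  exact hrows.congr fun s => (pairRowsR_eq (P s) (cs s)).symm

/-! ### The common denominator, the residue rows, the capped subgroup order -/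

/-- `lcmDen` through the list lcm of `HallgrenClassGroupHowell.lean`. [folklore] -/
theorem lcmDen_eq (rows : List (List ℚ)) : lcmDen rows = Howell.listLcm (rows.map fun row => Howell.listLcm (row.map Rat.den)) := by
  unfold lcmDen
  rw [HowellFP.foldl_lcm_eq, Nat.lcm_one_left]
  congr 1
  refine List.map_congr_left fun row _ => ?_
  rw [HowellFP.foldl_lcm_eq, Nat.lcm_one_left]

/-- **The common denominator is computed on codes.** [cite: CheungMosca2001, §3] -/
theorem codeFP_lcmDen : CodeFP (rawE (rawE encodeRat)) natE lcmDen :=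
  (HowellFP.listLcmC.comp (map₀ (HowellFP.listLcmC.comp (map₀ ratNumDen.snd')))).congr fun rows => (lcmDen_eq rows).symm

/-- **The residue rows `(N ζ) mod N` are computed on codes.** [cite: CheungMosca2001, §3] -/
theorem codeFP_natRows : CodeFP (pairE natE (rawE (rawE encodeRat))) (rawE (rawE natE)) (fun p => natRows p.1 p.2) := by
  have hg : CodeFP (pairE natE encodeRat) natE (fun q => ((q.2 * (q.1 : ℚ)).num % (q.1 : ℤ)).toNat) := by
    have hN : CodeFP (pairE natE encodeRat) intE (fun q => (q.1 : ℤ)) := intOfNat.comp (fst _ _)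
    have hm : CodeFP (pairE natE encodeRat) encodeRat (fun q => q.2 * (q.1 : ℚ)) :=
      (ratMul.comp ((snd _ _).pair (PeriodFinding.ratOfInt'.comp hN))).congr fun q => by push_cast; rfl
    exact (intToNat.comp (intEModOf (ratNumDen.comp hm).fst' hN) :)
  have hrow : CodeFP (pairE natE (rawE encodeRat)) (rawE natE) (fun q => q.2.map fun ζ => ((ζ * (q.1 : ℚ)).num % (q.1 : ℤ)).toNat) := map hg
  exact ((map (hrow.comp ((fst _ _).fst'.pair (snd _ _)))).comp (((fst _ _).pair (CodeFP.id _)).pair (snd _ _))).congr fun p => rfl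

/-- **The capped post-processor is computed on codes** (pointwise form): the subgroup order of the residue rows of the
derived rows (`HowellFP.subgroupOrderPureC`) when their common denominator is at most `B`, else `0` — the unfolding of
`PostParams.postOutC`. [cite: Hallgren2005, §4; CheungMosca2001, §3; AroraBarak2009, §1.3] -/
theorem codeFP_postOutCap {cs : σ → List ℕ} (hT : CodeFP eσ unE (fun s => (P s).T)) (hℓe : CodeFP eσ unE (fun s => (P s).ℓe))
    (hs : CodeFP eσ unE (fun s => (P s).s)) (haexp : CodeFP eσ unE (fun s => (P s).aexp))
    (htop : CodeFP eσ unE (fun s => (P s).top)) (hK₀ : CodeFP eσ natE (fun s => (P s).K₀)) (hB : CodeFP eσ natE (fun s => (P s).B))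
    (hcs : CodeFP eσ (rawE natE) cs) :
    CodeFP eσ natE (fun s => if lcmDen ((P s).pairRowsR (cs s)) ≤ (P s).B then (P s).postOutR (cs s) else 0) := by
  have hrows := codeFP_pairRowsR hT hℓe hs haexp htop hK₀ hB hcs
  have hN := codeFP_lcmDen.comp hrows
  have hnat := codeFP_natRows.comp (hN.pair hrows)
  have hord : CodeFP eσ natE (fun s => (P s).postOutR (cs s)) := (HowellFP.subgroupOrderPureC.comp (hN.pair (hT.pair hnat))).congr fun s => rfl
  have hc : CodeFP eσ bitE (fun s => decide (lcmDen ((P s).pairRowsR (cs s)) ≤ (P s).B)) := (natLe.comp (hN.pair hB) :)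
  refine ((hc.ite hord (const eσ (0 : ℕ))).congr fun s => ?_)
  by_cases h : lcmDen ((P s).pairRowsR (cs s)) ≤ (P s).B <;> simp [h]

end PostParams

end CubicClassPost

end Literature.Computability.Cryptography

end
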